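import Summits.AnomalousDissipation.AnomalousDissipation.Theorems.SolenoidalFractalHomogenisationLagrangianStepSidebandXEffMode
import Summits.AnomalousDissipation.AnomalousDissipation.Theorems.SolenoidalFractalHomogenisationLagrangianStepSidebandXInitial
import Summits.AnomalousDissipation.AnomalousDissipation.Theorems.SolenoidalFractalHomogenisationLagrangianStepWeakSolRestrict
import HarnessLib

/-!
# K1L_D `LagrangianRenormalisationStepDesign` (stmt-AnomalousDissipation-27980), `stub_D1_V0R` (ruling D27-1), brick T8d-(b,c): CURRENCY —
# the clause's left-hand side `2Σᵢ‖modeCoeff ℓ (w t − v t) i‖²` IS `2‖x(t) − exp(−tḠ)x(0)‖²` for a.e. `t`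
# (helper; `--kind proof --supports stmt-AnomalousDissipation-27980 --as helper`)

Summits-side helper file of route `SolenoidalFractalHomogenisation` (prover seat `ad-k1l-cellLawV-w1` g7; 0 sorry, no defs, no named facts).
For the single-mode datum `Re e_ℓ·p` (`ℓ ≠ 0`, `p ⊥ ℓ`), a weak solution `w` of the cell problem along `W₁.cell n` with tensor `𝔹`, and a weak
solution `v` of the drift-free effective problem with tensor `𝔹ₑ` on a horizon `T' ≥ T`: for a.e. `t ∈ (0,T)`,
`2Σᵢ‖modeCoeff ℓ (w t − v t) i‖² = 2‖modeRep … ℓ t − exp(−t•effGenC 𝔹ₑ ℓ r₁)(modeRep … ℓ 0)‖²` (any `r₁`): `CellChain.ae_eq_modeRep` (the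
slow mode of `w`), `LagrangianStep.effective_modeCoeff_eq` (the mode of `v` is `exp(−t·effGen 𝔹ₑ ℓ)(p/2)`), `…EffMode.exp_effGenC_realVec_eq`
(the complexified generator on the real transversal line) and `…Initial.modeRep_self_zero` (`x(0) = ½pᶜ`).
* `half_complexify_eq_realVec`, `sum_ell_mul_half_eq_zero`, **`ae_two_sum_modeCoeff_sub_eq`**.
NOT a proof of any registered stub, of K1L_D, or of anomalous dissipation; rung F-D1.A0 infrastructure.
-/

set_option linter.dupNamespace false

noncomputable section

namespace Summit.AnomalousDissipation.AnomalousDissipation.Theorems.SolenoidalFractalHomogenisation.LagrangianStep.Sideband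

open Set MeasureTheory Complex UnitAddTorus NormedSpace
open scoped InnerProductSpace
open Literature.Analysis Literature.Analysis.FunctionSpaces Literature.Analysis.FunctionSpaces.Torus
open Literature.Analysis.FluidPDE Literature.Analysis.FluidPDE.Torus Literature.Analysis.FluidPDE.LatticeShear
open Summit.AnomalousDissipation.AnomalousDissipation.Theorems.SolenoidalFractalHomogenisation.LagrangianStep.CellChain (modeRep ae_eq_modeRep)
open Summit.AnomalousDissipation.AnomalousDissipation.Theorems.SolenoidalFractalHomogenisation.RealisedQuasiStaticCellLaw
  (memLp_two_of_memSobolev_one_complexify memSobolev_one_singleMode)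
open Summit.AnomalousDissipation.AnomalousDissipation.Theorems.SolenoidalFractalHomogenisation.LagrangianStep (effective_modeCoeff_eq effGen)

variable {k₀ : ℕ}

/-- `½·pᶜ` as the complexified real vector `p/2`. [folklore] -/
theorem half_complexify_eq_realVec (p : EuclideanSpace ℝ (Fin 3)) :
    (2 : ℂ)⁻¹ • FunctionSpaces.EuclideanSpace.complexify p = WithLp.toLp 2 (fun i => (((p i / 2 : ℝ)) : ℂ)) := by
  ext i
  rw [PiLp.smul_apply, FunctionSpaces.EuclideanSpace.complexify_apply, smul_eq_mul]
  change _ = (((p i / 2 : ℝ)) : ℂ)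
  push_cast
  ring

/-- `Σⱼ ℓⱼ·(pⱼ/2) = 0` for `p ⊥ ℓ`. [folklore] -/
theorem sum_ell_mul_half_eq_zero {ℓ : Fin 3 → ℤ} {p : EuclideanSpace ℝ (Fin 3)} (hp : ⟪p, Torus.latticeVec ℓ⟫_ℝ = 0) :
    ∑ j, (ℓ j : ℝ) * (p j / 2) = 0 := by
  have h2 : ∑ j, p j * (ℓ j : ℝ) = ⟪p, Torus.latticeVec ℓ⟫_ℝ := by
    rw [EuclideanSpace.inner_eq_star_dotProduct]
    simp only [dotProduct, star_trivial, Torus.latticeVec_apply]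
    exact Finset.sum_congr rfl fun j _ => mul_comm _ _
  have h3 : ∑ j, (ℓ j : ℝ) * (p j / 2) = (∑ j, p j * (ℓ j : ℝ)) / 2 := by
    rw [Finset.sum_div]; exact Finset.sum_congr rfl fun j _ => by ring
  rw [h3, h2, hp, zero_div]

/-- **CURRENCY**: for a.e. `t ∈ (0,T)`, `2Σᵢ‖modeCoeff ℓ (w t − v t) i‖² = 2‖x(t) − exp(−t•effGenC 𝔹ₑ ℓ r₁) x(0)‖²`.
[cite: Temam1984, Ch. III §1.1] [cite: MajdaKramer1999, §2.2.1.3 (55)] -/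
theorem ae_two_sum_modeCoeff_sub_eq (W₁ : LatticeWord k₀) (n : ℕ) {T T' : ℝ} (hT : 0 < T) (hTT' : T ≤ T') {𝔹 𝔹e : Torus.Visc4 (Fin 3)}
    {ℓ : Fin 3 → ℤ} (hℓ0 : ℓ ≠ 0) {p : EuclideanSpace ℝ (Fin 3)} (hp : ⟪p, Torus.latticeVec ℓ⟫_ℝ = 0)
    {w v : ℝ → UnitAddTorus (Fin 3) → EuclideanSpace ℝ (Fin 3)}
    (h : Torus.IsWeakTensorPassiveVectorOn 0 T 𝔹 (W₁.cell n) (fun x => (UnitAddTorus.mFourier ℓ x).re • p) w)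
    (hv : Torus.IsWeakTensorPassiveVectorOn 0 T' 𝔹e (fun _ _ => 0) (fun x => (UnitAddTorus.mFourier ℓ x).re • p) v) (r₁ : ℝ) :
    ∀ᵐ t ∂(volume.restrict (Ioo 0 T)),
      2 * ∑ i, ‖modeCoeff ℓ (fun x => w t x - v t x) i‖ ^ 2 =
        2 * ‖modeRep W₁ n 𝔹 (fun x => (UnitAddTorus.mFourier ℓ x).re • p) w ℓ t -
          exp (-(t • effGenC 𝔹e ℓ r₁)) (modeRep W₁ n 𝔹 (fun x => (UnitAddTorus.mFourier ℓ x).re • p) w ℓ 0)‖ ^ 2 := by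
  have hv' := WeakSol.mono_horizon hv hTT'
  have hFi : Integrable (fun x : UnitAddTorus (Fin 3) => (UnitAddTorus.mFourier ℓ x).re • p) volume :=
    (memLp_two_of_memSobolev_one_complexify (memSobolev_one_singleMode ℓ p)).integrable one_le_two
  have hx0 : modeRep W₁ n 𝔹 (fun x => (UnitAddTorus.mFourier ℓ x).re • p) w ℓ 0 = WithLp.toLp 2 (fun i => (((p i / 2 : ℝ)) : ℂ)) := by
    rw [modeRep_self_zero W₁ n 𝔹 hℓ0 hp w, half_complexify_eq_realVec]
  filter_upwards [ae_restrict_mem measurableSet_Ioo, ae_eq_modeRep W₁ n hT.le h hFi ℓ, effective_modeCoeff_eq hℓ0 hp hv',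
    h.ae_memLp_two, hv'.ae_memLp_two] with t htI hw hveq hw2 hv2
  have hwi : Integrable (w t) volume := hw2.integrable one_le_two
  have hvi : Integrable (v t) volume := hv2.integrable one_le_two
  have hcw : Integrable (FunctionSpaces.EuclideanSpace.complexify ∘ w t) volume :=
    FunctionSpaces.EuclideanSpace.complexify.toContinuousLinearMap.integrable_comp hwi
  have hcv : Integrable (FunctionSpaces.EuclideanSpace.complexify ∘ v t) volume :=
    FunctionSpaces.EuclideanSpace.complexify.toContinuousLinearMap.integrable_comp hvi
  have hX : exp (-(t • effGenC 𝔹e ℓ r₁)) (modeRep W₁ n 𝔹 (fun x => (UnitAddTorus.mFourier ℓ x).re • p) w ℓ 0) =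
      WithLp.toLp 2 (fun i => (((exp (-(t • effGen 𝔹e ℓ))).mulVec (fun i => p i / 2) i : ℝ) : ℂ)) := by
    rw [hx0]
    exact exp_effGenC_realVec_eq 𝔹e hℓ0 r₁ (sum_ell_mul_half_eq_zero hp) htI.1.le
  have hcoef : ∀ i, modeCoeff ℓ (fun x => w t x - v t x) i =
      (modeRep W₁ n 𝔹 (fun x => (UnitAddTorus.mFourier ℓ x).re • p) w ℓ t -
        exp (-(t • effGenC 𝔹e ℓ r₁)) (modeRep W₁ n 𝔹 (fun x => (UnitAddTorus.mFourier ℓ x).re • p) w ℓ 0)) i := by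
    intro i
    have hint : Integrable (fun x => w t x - v t x) volume := hwi.sub hvi
    have hcomp : (FunctionSpaces.EuclideanSpace.complexify ∘ fun x => w t x - v t x) =
        (FunctionSpaces.EuclideanSpace.complexify ∘ w t) - (FunctionSpaces.EuclideanSpace.complexify ∘ v t) := by
      funext x; simp [map_sub]
    rw [modeCoeff_eq hint, hcomp, mFourierCoeff_sub hcw hcv, PiLp.sub_apply, PiLp.sub_apply, hw, hX]
    congr 1
    rw [← modeCoeff_eq hvi, hveq i]
  simp only [hcoef]
  rw [PiLp.norm_sq_eq_of_L2]

end Summit.AnomalousDissipation.AnomalousDissipation.Theorems.SolenoidalFractalHomogenisation.LagrangianStep.Sideband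

end
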